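import Summits.QuantumFields.BalabanUV.T4Continuum.Support.CovariantMeanRecursion
import Literature.MathematicalPhysics.QuantumFieldTheory.Balaban1983to89.T4AdInvariant

/-!
# `T4Continuum.CovariantMeanDepth` (cell-tree module `Summits/QuantumFields/BalabanUV/T4Continuum/Support/CovariantMeanDepth.lean`)
# — road P4 of the spine estimate NE1′, tangent-map formulation (v2): the two abstract halves of the DEPTH LEMMA L8-DL —
# (§1) FLATNESS-ZERO FROM COVARIANCE: an equivariant vector-valued functional vanishes at every configuration fixed by a
# subgroup without fixed vectors, hence on the whole orbit of such a configuration («pure gauges»); the `su(2)` instance via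
# `…T4AdInvariant.traceless_eq_zero_of_conj_invariant'` BY NAME;
# (§2) THE GAUGE DISC INSIDE A CURVATURE-DEFINED SPACE: for a «curvature» map `curv A = d A + b A A` (linear + bilinear,
# the shape of `F(A) = dA + [A∧A]`), the disc `w ↦ w • A` stays inside `{‖curv ·‖ < α, ‖·‖ < R}` up to radius `Λ` as soon as
# `Λ‖dA‖ + Λ²‖bAA‖ < α` and `Λ‖A‖ < R`; with §2 of `CovariantMeanRecursion` this yields the covariant-mean GAIN
# `‖Φ A‖ ≤ N/Λ`, and in the «deep» regime (curvature `≤ θα`, quadratic term `≤ θ²α`) the explicit gain `‖Φ A‖ ≤ 3θ·N`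
# (cell `pub-balaban`, sub-cell `t4`, ROUND-2 prover seat #4 of BINDER-OWNERS row NE1′, unit `b2b-balaban-t4-ne1p-p4`,
# generation 2; companion of the HOME record `t4/b2b-balaban-t4-ne1p-p4/PROPAGATION-v2.md` §2.3, §4.3 and of the skeleton
# `t4/skeletons/NE1p-t4-ne1p-p4.md` v2.0 leaves L6c, L8-DL; ADDITIVE — imports its sibling `Support.CovariantMeanRecursion`
# (p209931) and `…Balaban1983to89.T4AdInvariant` only; nothing modified)

HONEST FRAMING.  Finite four-torus, rung (B)+1 only.  NOT infinite volume, NOT a mass gap, NOT the Clay problem, NOT summit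
progress.  HONEST DEPENDENCY: continuum YM on T⁴ ⇐ BetaPertH ∧ nine spine estimates (0/9 proved); BetaPertH ⇐ (D1) ∧ (D4) ∧
CAP+tail; G-an2-4 gates asym, D1 and NE2/3/4.  This module is elementary (group actions, normed-space estimates, one call to
the disc form of the Schwarz lemma); it asserts nothing about T. Bałaban's densities or spaces; every declaration is [folklore]
and sorry-free.  In the road, `E` = axial-gauge potentials on a localization domain around the nearest pure gauge, `curv` = the
lattice curvature in those coordinates, `α` = the plaquette radius of the printed multi-scale space at the BIRTH scale of the
functional, `θ ≍ L^{−2s}` = the relative depth of a configuration regular `s` scales deeper — the identification of Bałaban's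
spaces with this model (the axial-gauge dictionary, the typed radii of `…B14Radii`) is the remaining, separate part of leaf
L8-DL and is NOT done here.

CITATION HEADER (lean-in-tree rule).  No page of the series (CMP 1983–89) or of any other source is quoted or attributed here.
Objects re-used BY NAME: `…T4AdInvariant.traceless_eq_zero_of_conj_invariant'` (pv lineage; Schur for the defining
representation of SU(2) in coordinates), `CovariantMeanRecursion.norm_le_div_of_disc` (this seat, p209931).
-/

noncomputable section

open Metric Set

namespace Summit.QuantumFields.BalabanUV.T4Continuum.CovariantMeanDepth

/-! ## §1 Flatness-zero from covariance (skeleton leaf L6c; record §2.3 «M3 ⇐ M1 + exact locality») -/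

section FlatnessZero

variable {𝒢 X V : Type*} [Group 𝒢] [MulAction 𝒢 X] [AddCommGroup V] [Module ℝ V]

/-- An equivariant vector-valued functional vanishes at a configuration `x₀` fixed by a set `H` of symmetries whose
representing maps have no common fixed vector: `Φ x₀ = ρ h (Φ x₀)` for all `h ∈ H`, hence `Φ x₀ = 0`.  On the road: `x₀` =
the trivial configuration, `H` = the constant gauge transformations, `V` = `su(2)` with the adjoint action. [folklore] -/
theorem eq_zero_of_equivariant_of_fixed (ρ : 𝒢 → V →ₗ[ℝ] V) (Φ : X → V) (hΦ : ∀ (g : 𝒢) (x : X), Φ (g • x) = ρ g (Φ x))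
    (x₀ : X) (H : Set 𝒢) (hfix : ∀ h ∈ H, h • x₀ = x₀) (hno : ∀ v : V, (∀ h ∈ H, ρ h v = v) → v = 0) : Φ x₀ = 0 := by
  apply hno
  intro h hh
  have := hΦ h x₀
  rw [hfix h hh] at this
  exact this.symm

/-- … hence it vanishes on the whole orbit of `x₀` (the «pure gauges» `g • x₀`). [folklore] -/
theorem eq_zero_on_orbit (ρ : 𝒢 → V →ₗ[ℝ] V) (Φ : X → V) (hΦ : ∀ (g : 𝒢) (x : X), Φ (g • x) = ρ g (Φ x))
    (x₀ : X) (H : Set 𝒢) (hfix : ∀ h ∈ H, h • x₀ = x₀) (hno : ∀ v : V, (∀ h ∈ H, ρ h v = v) → v = 0)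
    {x : X} (hx : ∃ g : 𝒢, x = g • x₀) : Φ x = 0 := by
  obtain ⟨g, rfl⟩ := hx
  rw [hΦ, eq_zero_of_equivariant_of_fixed ρ Φ hΦ x₀ H hfix hno, map_zero]

omit [MulAction 𝒢 X] in
/-- LOCALITY: if `Φ` factors through a restriction map `r : X → Y` (`Φ = Φ' ∘ r`, `Φ'` equivariant) then `Φ x = 0` as soon as
the RESTRICTION of `x` is a pure gauge — the configuration may be anything outside the localization domain. [folklore] -/
theorem eq_zero_of_restrict_pure {Y : Type*} [MulAction 𝒢 Y] (ρ : 𝒢 → V →ₗ[ℝ] V) (r : X → Y)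
    (Φ' : Y → V) (hΦ' : ∀ (g : 𝒢) (y : Y), Φ' (g • y) = ρ g (Φ' y)) (y₀ : Y) (H : Set 𝒢)
    (hfix : ∀ h ∈ H, h • y₀ = y₀) (hno : ∀ v : V, (∀ h ∈ H, ρ h v = v) → v = 0) {x : X}
    (hx : ∃ g : 𝒢, r x = g • y₀) : (Φ' ∘ r) x = 0 :=
  eq_zero_on_orbit ρ Φ' hΦ' y₀ H hfix hno hx

/-- Flatness-zero, `su(2)` form: a traceless-matrix-valued functional on configurations, equivariant under a group `𝒢` acting
on values by conjugation through a homomorphism `u : 𝒢 →* SU(2)` whose restriction to `H ⊆ 𝒢` is ONTO `SU(2)` (the constant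
gauge transformations), vanishes at every configuration fixed by `H` and on its `𝒢`-orbit. [folklore] -/
theorem su2_eq_zero_on_orbit (u : 𝒢 →* Matrix.specialUnitaryGroup (Fin 2) ℂ) (Φ : X → Matrix (Fin 2) (Fin 2) ℂ)
    (htr : ∀ x, (Φ x).trace = 0)
    (hΦ : ∀ (g : 𝒢) (x : X), Φ (g • x) = (u g : Matrix (Fin 2) (Fin 2) ℂ) * Φ x * star (u g : Matrix (Fin 2) (Fin 2) ℂ))
    (x₀ : X) (H : Set 𝒢) (hfix : ∀ h ∈ H, h • x₀ = x₀)
    (honto : ∀ U : Matrix.specialUnitaryGroup (Fin 2) ℂ, ∃ h ∈ H, u h = U)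
    {x : X} (hx : ∃ g : 𝒢, x = g • x₀) : Φ x = 0 := by
  have h0 : Φ x₀ = 0 := by
    apply Literature.MathematicalPhysics.QuantumFieldTheory.Balaban1983to89.T4AdInvariant.traceless_eq_zero_of_conj_invariant'
      _ (htr x₀)
    intro U
    obtain ⟨h, hh, rfl⟩ := honto U
    have := hΦ h x₀
    rw [hfix h hh] at this
    exact this.symm
  obtain ⟨g, rfl⟩ := hx
  rw [hΦ, h0, mul_zero, zero_mul]

end FlatnessZero

/-! ## §2 The gauge disc inside a curvature-defined space (skeleton leaf L8-DL, geometric half; record §4.3) -/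

section Disc

variable {E E' F : Type*} [NormedAddCommGroup E] [NormedSpace ℂ E] [NormedAddCommGroup E'] [NormedSpace ℂ E']
  [NormedAddCommGroup F] [NormedSpace ℂ F]

/-- A «curvature» of the shape `F(A) = dA + [A ∧ A]`: a continuous linear part plus a continuous bilinear part (a MODEL
object: no statement about Bałaban's spaces is made by this structure). [folklore] -/
structure CurvData (E E' : Type*) [NormedAddCommGroup E] [NormedSpace ℂ E] [NormedAddCommGroup E'] [NormedSpace ℂ E']
    where
  /-- the linear part (`A ↦ dA`) -/
  d : E →L[ℂ] E'
  /-- the bilinear part (`(A, A′) ↦ [A ∧ A′]`) -/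
  b : E →L[ℂ] E →L[ℂ] E'

/-- `curv c A = d A + b A A`. [folklore] -/
def CurvData.curv (c : CurvData E E') (A : E) : E' := c.d A + c.b A A

/-- The model space: curvature below `α`, potential below `R` (both strict). [folklore] -/
def CurvData.space (c : CurvData E E') (α R : ℝ) : Set E := {A | ‖c.curv A‖ < α ∧ ‖A‖ < R}

/-- `curv` is continuous. [folklore] -/
theorem CurvData.continuous_curv (c : CurvData E E') : Continuous c.curv := by
  unfold CurvData.curv
  fun_prop

/-- The model space is open. [folklore] -/
theorem CurvData.isOpen_space (c : CurvData E E') (α R : ℝ) : IsOpen (c.space α R) := by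
  unfold CurvData.space
  exact (isOpen_lt (continuous_norm.comp c.continuous_curv) continuous_const).inter
    (isOpen_lt continuous_norm continuous_const)

/-- The pure gauge `A = 0` lies in the model space. [folklore] -/
theorem CurvData.zero_mem_space (c : CurvData E E') {α R : ℝ} (hα : 0 < α) (hR : 0 < R) : (0 : E) ∈ c.space α R := by
  simp [CurvData.space, CurvData.curv, hα, hR]

/-- Scaling of the curvature along the disc: `curv (w • A) = w • dA + w² • bAA`. [folklore] -/
theorem CurvData.curv_smul (c : CurvData E E') (w : ℂ) (A : E) :
    c.curv (w • A) = w • c.d A + (w * w) • c.b A A := by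
  simp [CurvData.curv, smul_smul]

/-- … hence `‖curv (w • A)‖ ≤ ‖w‖·‖dA‖ + ‖w‖²·‖bAA‖`. [folklore] -/
theorem CurvData.norm_curv_smul_le (c : CurvData E E') (w : ℂ) (A : E) :
    ‖c.curv (w • A)‖ ≤ ‖w‖ * ‖c.d A‖ + ‖w‖ ^ 2 * ‖c.b A A‖ := by
  rw [c.curv_smul]
  calc ‖w • c.d A + (w * w) • c.b A A‖ ≤ ‖w • c.d A‖ + ‖(w * w) • c.b A A‖ := norm_add_le _ _
    _ = ‖w‖ * ‖c.d A‖ + ‖w‖ ^ 2 * ‖c.b A A‖ := by rw [norm_smul, norm_smul, norm_mul, sq]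

/-- THE DISC STAYS INSIDE: if `Λ‖dA‖ + Λ²‖bAA‖ < α` and `Λ‖A‖ < R` then `w • A ∈ space α R` for every `‖w‖ < Λ`. [folklore] -/
theorem CurvData.smul_mem_space (c : CurvData E E') {A : E} {α R Λ : ℝ}
    (h1 : Λ * ‖c.d A‖ + Λ ^ 2 * ‖c.b A A‖ < α) (h2 : Λ * ‖A‖ < R) {w : ℂ} (hw : ‖w‖ < Λ) :
    w • A ∈ c.space α R := by
  have hw0 : 0 ≤ ‖w‖ := norm_nonneg w
  constructor
  · calc ‖c.curv (w • A)‖ ≤ ‖w‖ * ‖c.d A‖ + ‖w‖ ^ 2 * ‖c.b A A‖ := c.norm_curv_smul_le w A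
      _ ≤ Λ * ‖c.d A‖ + Λ ^ 2 * ‖c.b A A‖ := by
          gcongr
      _ < α := h1
  · calc ‖w • A‖ = ‖w‖ * ‖A‖ := norm_smul w A
      _ ≤ Λ * ‖A‖ := mul_le_mul_of_nonneg_right hw.le (norm_nonneg A)
      _ < R := h2

/-- `MapsTo` form of the preceding lemma for the disc `w ↦ w • A`. [folklore] -/
theorem CurvData.mapsTo_disc (c : CurvData E E') {A : E} {α R Λ : ℝ}
    (h1 : Λ * ‖c.d A‖ + Λ ^ 2 * ‖c.b A A‖ < α) (h2 : Λ * ‖A‖ < R) :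
    MapsTo (fun w : ℂ => w • A) (ball 0 Λ) (c.space α R) := by
  intro w hw
  rw [mem_ball, dist_zero_right] at hw
  exact c.smul_mem_space h1 h2 hw

/-- **THE DEPTH GAIN (parametric form).**  Let `Φ` be differentiable on the model space `space α R`, bounded by `N` there and
vanishing at `0` (the pure gauge: §1).  If the configuration `A` is deep — `Λ‖dA‖ + Λ²‖bAA‖ < α` and `Λ‖A‖ < R` for some
`Λ > 1` — then `‖Φ A‖ ≤ N/Λ`.  [folklore] -/
theorem depth_gain (c : CurvData E E') {Φ : E → F} {α R Λ N : ℝ} {A : E} (hΛ : 1 < Λ)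
    (hΦ : DifferentiableOn ℂ Φ (c.space α R)) (hN : ∀ B ∈ c.space α R, ‖Φ B‖ ≤ N) (h0 : Φ 0 = 0)
    (h1 : Λ * ‖c.d A‖ + Λ ^ 2 * ‖c.b A A‖ < α) (h2 : Λ * ‖A‖ < R) : ‖Φ A‖ ≤ N / Λ := by
  have hmaps := c.mapsTo_disc h1 h2
  have hψ : Differentiable ℂ (fun w : ℂ => w • A) := by fun_prop
  have h0' : Φ ((fun w : ℂ => w • A) 0) = 0 := by simp only [zero_smul]; exact h0
  have h := CovariantMeanRecursion.norm_le_div_of_disc hΛ (c.isOpen_space α R) hΦ hN hψ hmaps h0'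
  simpa using h

/-- **THE DEPTH GAIN (deep regime, explicit).**  If the curvature of `A` is at relative depth `θ` (`‖curv A‖ ≤ θα`), the
quadratic term is second order in the depth (`‖bAA‖ ≤ θ²α` — on the road: `(‖b‖·diam²·α)·θ²α` with the bracket `≤ 1`, the
numeric side condition N2′), the potential fits (`‖A‖ < 3θR`) and `0 < θ < 1/3`, then with `Λ = 1/(3θ)`:
`‖Φ A‖ ≤ 3θ·N` — the covariant-mean gain is (three times) the relative depth.  On the road `θ ≍ (α_{0,j}/α_{0,i})·L^{−2(j−i)}`.
[folklore] -/
theorem depth_gain_deep (c : CurvData E E') {Φ : E → F} {α R θ N : ℝ} {A : E} (hθ0 : 0 < θ) (hθ : θ < 1 / 3)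
    (hα : 0 < α)
    (hΦ : DifferentiableOn ℂ Φ (c.space α R)) (hN : ∀ B ∈ c.space α R, ‖Φ B‖ ≤ N) (h0 : Φ 0 = 0)
    (hcurv : ‖c.curv A‖ ≤ θ * α) (hquad : ‖c.b A A‖ ≤ θ ^ 2 * α) (hpot : ‖A‖ < 3 * θ * R) :
    ‖Φ A‖ ≤ 3 * θ * N := by
  -- the linear part is controlled by curvature + quadratic part
  have hd : ‖c.d A‖ ≤ θ * α + θ ^ 2 * α := by
    have : c.d A = c.curv A - c.b A A := by simp [CurvData.curv]
    rw [this]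
    exact (norm_sub_le _ _).trans (add_le_add hcurv hquad)
  set Λ : ℝ := 1 / (3 * θ) with hΛdef
  have hΛ1 : 1 < Λ := by
    rw [hΛdef, lt_div_iff₀ (by positivity)]; linarith
  have hΛ0 : 0 < Λ := zero_lt_one.trans hΛ1
  have hΛθ : Λ * θ = 1 / 3 := by rw [hΛdef]; field_simp
  have h1 : Λ * ‖c.d A‖ + Λ ^ 2 * ‖c.b A A‖ < α := by
    have e1 : Λ * ‖c.d A‖ ≤ Λ * (θ * α + θ ^ 2 * α) := mul_le_mul_of_nonneg_left hd hΛ0.le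
    have e2 : Λ ^ 2 * ‖c.b A A‖ ≤ Λ ^ 2 * (θ ^ 2 * α) := mul_le_mul_of_nonneg_left hquad (by positivity)
    have e3 : Λ * (θ * α + θ ^ 2 * α) = (1 / 3) * α + (1 / 3) * θ * α := by
      have : Λ * (θ * α + θ ^ 2 * α) = (Λ * θ) * α + (Λ * θ) * θ * α := by ring
      rw [this, hΛθ]
    have e4 : Λ ^ 2 * (θ ^ 2 * α) = (1 / 9) * α := by
      have : Λ ^ 2 * (θ ^ 2 * α) = (Λ * θ) ^ 2 * α := by ring
      rw [this, hΛθ]; norm_num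
    have hθα : θ * α < (1 / 3) * α := by nlinarith
    nlinarith [e1, e2, e3, e4, hθα]
  have h2 : Λ * ‖A‖ < R := by
    have hR : 0 < R := by
      have : (0 : ℝ) ≤ ‖A‖ := norm_nonneg A
      nlinarith
    calc Λ * ‖A‖ < Λ * (3 * θ * R) := mul_lt_mul_of_pos_left hpot hΛ0
      _ = 3 * (Λ * θ) * R := by ring
      _ = R := by rw [hΛθ]; ring
  have h := depth_gain c hΛ1 hΦ hN h0 h1 h2
  calc ‖Φ A‖ ≤ N / Λ := h
    _ = 3 * θ * N := by rw [hΛdef]; field_simp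

end Disc

end Summit.QuantumFields.BalabanUV.T4Continuum.CovariantMeanDepth
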